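import Summits.BirchSwinnertonDyer.BirchSwinnertonDyer.Theses.PrintX6
import Summits.BirchSwinnertonDyer.BirchSwinnertonDyer.Theorems.PrintX6KobayashiUpperHalf
import Summits.BirchSwinnertonDyer.Rank1Residual.Supersingular.X6RestCellKimTamDefectLocalTorsionTrivial
import HarnessLib

/-!
# Route `PrintX6`, residual `EisensteinHalfFiveLeRest` (stmt-BirchSwinnertonDyer-21116): the Tam-defect Rest cell `(399190l1, p = 7)`
# CLOSED ON THE ROUTE'S TRUST BASE — `BSD(E,7)` from `PublishedInputsX6` (upper half = the PROVED item `UpperHalfX6`) + the flag-free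
# Kurihara-number lower half p556626 (proof-covered Kim twin), NO Perrin-Riou Prop. 4.8 (cell `bsd-print-x6`, seat p4 gen 3;
# `--supports` stmt-21116 as helper; closes no item)

PARTITION currency (D-0054): ONE cell of the declared residual, per pair; nothing booked; BEYOND-PRINT THEOREM: **NO**.
The road of record `Supersingular.bsdp_x6r0tam_399190l1_7` reads its upper half from Perrin-Riou 2003 Prop. 4.8 (flag
`PR03-Prop4.8-Kato-attribution`) and its lower half from the flagged Kim 2026 fact; here the upper half is the route's `UpperHalfX6` chain
(`X6.missingUpperBoundAt_rankZero_of_thm41`: Kobayashi 2003 Thm 4.1/1.2 + B. D. Kim 2013 Cor 3.15 + period units + Pollack + modularity +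
GZK = conjuncts of `PublishedInputsX6`) and the lower half is `Supersingular.X6RankZero.missingLowerBoundAt_cell_399190l1_at7_LT` (depth-2
Kurihara number at `6763·23227` through `Kim2026.…_of_localTorsionTrivial`, unflagged). Binders: `PublishedInputsX6`, the Kim twin, the
model, and the displayed data of the road of record (`r_an = 0`, `2 ≤ ord₇ ∏c + 1`, Manin datum `D` with `7 ∤ c_D`, period transfer, `ψ`,
`hδ` — engine Q kit j247638 / j255441). `ClassX6 W 7` is derived from the integer model (`#Ẽ(𝔽₇) = 8`, kernel count inlined).
References: [Kobayashi2003] Thm 1.2/4.1; [BDKim2013] Cor 3.15; [Kim2022StructureSelmer] Thm 1.9 (6); [Miller2011LMS] Def 1.1.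
-/

set_option autoImplicit false
set_option linter.dupNamespace false

noncomputable section

open scoped Classical MatrixGroups ModularForm

open CongruenceSubgroup WeierstrassCurve Literature.NumberTheory.EllipticCurves
  Literature.NumberTheory.EllipticCurves.Rank1Residual
  Literature.NumberTheory.EllipticCurves.Rank1Residual.Typed
  Literature.NumberTheory.EllipticCurves.Rank1Residual.X11RankOneCertificates
  Literature.NumberTheory.EllipticCurves.ModularForms
  Summit.BirchSwinnertonDyer.BirchSwinnertonDyer.Rank1Residual.IntModel
  Summit.BirchSwinnertonDyer.Rank1Residual.X11b
  Summit.BirchSwinnertonDyer.Rank1Residual.Supersingular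
  Summit.BirchSwinnertonDyer.BirchSwinnertonDyer.Theses.PrintX6

namespace Summit.BirchSwinnertonDyer.BirchSwinnertonDyer.Theorems.PrintX6

/-- **`BSD(E,7)` for `E = 399190l1` on the route's trust base — no Perrin-Riou Prop. 4.8, no flagged fact.** Upper half:
`X6.missingUpperBoundAt_rankZero_of_thm41` from the conjuncts of `PublishedInputsX6`; lower half:
`X6RankZero.missingLowerBoundAt_cell_399190l1_at7_LT` (p556626; depth-2 Kurihara number through the proof-covered Kim twin, GZK and
modularity = conjuncts 9 and 8 of the pack); `ClassX6 W 7` from the integer model (`classX6_of_intModel`, kernel point count `#Ẽ(𝔽₇) = 8` inlined — the named count is `Theorems.card_c399190l1_7` of route SignedLowerHalves' scope file, not imported here);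
then `missingPPartAt_of_lower_of_upper` and `bsdp_of_missingPPartAt`. Displayed binders as the road of record `bsdp_x6r0tam_399190l1_7`.
Per pair; not a class theorem. [cite: Kobayashi2003, Thm. 4.1 (p. 8) and Thm. 1.2 (p. 2)] [cite: BDKim2013, Cor. 3.15 (p. 199)]
[cite: Kim2022StructureSelmer, Thm. 1.9 (6) (PDF p. 8)] [cite: Miller2011LMS, §1 and Def. 1.1] [cite: Cremona2006, Table 1 (Cremona label 399190l1)] -/
theorem X6.bsdp_399190l1_at7_of_publishedInputsX6 (hPub : PublishedInputsX6)
    (hKim : Kim2026.rankZero_le_padicValNat_sha_of_kuriharaNumber_ne_zero_of_localTorsionTrivial)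
    {W : WeierstrassCurve ℚ} [W.IsElliptic] [W.IsGloballyMinimal]
    (hWeq : W = ⟨1, -1, 1, -8615202972, -2594053676135591⟩) (hr0 : W.analyticRank = 0)
    (hkt : 2 ≤ padicValNat 7 W.tamagawaProduct + 1)
    {N : ℕ} [NeZero N] (D : ModularParametrizationData W N) (hc : ¬ (7 : ℤ) ∣ D.maninConstant)
    (hper : ∃ u : ℚ, ‖(u : ℚ_[7])‖ = 1 ∧ W.realPeriodRat = u * plusPeriod D.f)
    (ψ : (ℓ : ℕ) → (ZMod ℓ)ˣ →* Multiplicative (ZMod (7 ^ 2)))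
    (hψ₁ : Function.Surjective (ψ 6763)) (hψ₂ : Function.Surjective (ψ 23227))
    (hδ : kuriharaNumber D.f (7 ^ 2) (6763 * 23227) ψ ≠ 0) : BSDp W 7 := by
  haveI : Fact (Nat.Prime 7) := ⟨by norm_num⟩
  obtain ⟨h12, h41, hKim315, hϖ, h3, -, hmod, hmod', hGZK⟩ := hPub
  have hIW : integralModelInt W = ⟨1, -1, 1, -8615202972, -2594053676135591⟩ :=
    integralModelInt_eq_of_map_eq _ (by rw [hWeq]; ext <;> simp [WeierstrassCurve.map])
  have hX : ClassX6 W 7 :=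
    classX6_of_intModel 7 (by norm_num) hIW (by decide +kernel)
      (natCard_point_eq_of_countPoints 1 (-1) 1 (-8615202972) (-2594053676135591) 7 (by norm_num) (by decide +kernel)
        (n := 8) (countPoints_eq_of_fast (by decide +kernel)))
      (by decide) (by decide +kernel)
  have hlow : MissingLowerBoundAt W 7 :=
    X6RankZero.missingLowerBoundAt_cell_399190l1_at7_LT hKim hGZK hmod' hWeq hr0 hkt D hc hper ψ hψ₁ hψ₂ hδ
  exact bsdp_of_missingPPartAt W 7 hGZK (by omega)
    (missingPPartAt_of_lower_of_upper W 7 hlow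
      (X6.missingUpperBoundAt_rankZero_of_thm41 W 7 h41 h12 hKim315 hϖ h3 hmod hmod' hGZK (by norm_num) hX hr0))

end Summit.BirchSwinnertonDyer.BirchSwinnertonDyer.Theorems.PrintX6

end
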